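import Summits.BirchSwinnertonDyer.Rank1Residual.AdditivePotMult.RamifiedOrdinaryLinePotMult
import Summits.BirchSwinnertonDyer.Rank1Residual.X2.GreenbergVatsalTateKummer
import HarnessLib

/-!
# The Tate line package of a MULTIPLICATIVE `V/ℚ` WITH ITS TWO LOCAL KUMMER INCLUSIONS at every
# subgroup `H ≤ Γ_ℚ` — the fact-free bottom of the `R-D` chain on the (M) rows (cell `b2b-bsdres`,
# team n1011, seat p07 (gen 5); input offered to row T-RD-Δ-K (n1011-p05) for its (M) instance;
# sequel of `RamifiedOrdinaryLinePotMult.exists_tateDatum_package` (TB-ROL B-M))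

HONEST FRAMING (cell `b2b-bsdres`, run/shared/lean/b2b/bsd-rank1-residual/, verbatim in every
file): the goal of the cell is to DELETE the COMBINATION-SHAPED residual classes of the
Birch–Swinnerton-Dyer formula for ALL analytic-rank `≤ 1` elliptic curves over `ℚ` — "full BSD
formula for every rank `≤ 1` curve in class `C`" assembled STRICTLY from published theorems — so
that the rank-`≤ 1` remainder becomes exactly the CONSTRUCTION-SHAPED classes, which are TYPED
(missing-input `Prop`s), NOT attempted. This is not "finishing BSD". Team n1011 (N10/N11; r2's
ROUTE-2 §II.15.3 ARM δ = the local identification `R-D` "`im κ = im λ_C`" behind the EPW consumers):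
research route; labels and marks UNCHANGED; nothing booked. Theorems only; NO definition; NO
Literature fact minted; the ONLY named facts are the PUBLISHED Tate uniformisation A40/A41
(Silverman *ATAEC* V.3.1 / V.5.3 / V.5.4, hypotheses `hT40`, `hT41`, exactly as in every X2 Tate file
and in TB-ROL B-M). Debt 0.

## What and why

On the (M) rows (`E = W` additive, potentially multiplicative at the odd prime `p`; `E ≅ V^{(p*)}` with
`V = E♭` MULTIPLICATIVE at `p`) the ramified ordinary line of Route G's EPW consumers is the Tate line
`C_v ≅ μ_{p^∞}` of `V` transported along the twist (TB-ROL B-M, `exists_tateDatum_package` +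
`twistMap`). The EPW reading rests on the local identification `im κ_w = im(H¹(·, C) → H¹(·, E[p^∞]))`
over `ℚ_{∞,w}` (flag `CG96-via-Coates99` of `EmertonPollackWeston2006/NearlyOrdinaryAlgebraicTransfer`).
r2's ARM δ / n1011-p05's row T-RD-Δ-K obtain it by PRIME-TO-`p` DESCENT from the level
`K·ℚ_∞`, `K = ℚ(√p*)`, where `E ≅ V`; on the (G-ord) rows the bottom of that chain is a cited fact
(Greenberg 1999 Prop. 2.4, cc-typer-2 p262636). THIS FILE records that on the (M) rows the bottom is
FACT-FREE: for the multiplicative `V` and its Tate datum `N` (from A40/A41) BOTH local inclusions hold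
at EVERY subgroup `H ≤ Γ_ℚ` —
* `N.strictKer H ≤ V.localKerOver p H ℚ_v` — Greenberg LNM 1716 p. 76 "`Im(λ_K) ⊆ Im(κ_K)` for every
  algebraic extension `K` of `F_v`", PROVED in the tree by X2 (`GreenbergVatsalTateKummer.strictKer_le_localKerOver_tate`,
  continuous Hilbert 90; split case with `t = 0`, non-split with `t = √γ`);
* `V.localKerOver p H ℚ_v ≤ N.greenbergKer H` — the Kummer compatibility of the Tate datum
  (`GreenbergVatsalTateDatum.tateDatum_kummer`: `σu/u` is a principal unit) fed to X2's
  `GreenbergVatsalSelmerLink.localKerOver_le_greenbergKer`.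
`exists_tateDatum_package_kummer` = TB-ROL B-M's `exists_tateDatum_package` (inertia trivial on
`V[p^∞]/C`, `C` divisible, `#C[p] = p`, `χ_p` on `C[p]`) + these two clauses, for the SAME datum — so
the (M) instance of p05's descent (his `strictKer_le_localKerOver_kerSubgroup_of_index_coprime` at
`U = galRange ℚ(√p*)`, index `2`) starts from a theorem, not a fact; the twist transport to `E` and the
descent itself are T-RD-Δ-K's files (consumed there BY NAME; nothing of them is restated here).

What is NOT claimed: anything about the additive curve `E` itself (that is the descent's output);
`p = 2`; the equality `strictKer = greenbergKer` for `V` over `ℚ_∞` (X2 gen-12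
`GreenbergVatsalStrictAtNonsplit/AtSplit`). X4(M)/X3♯(M) stay CONSTRUCTION-SHAPED; nothing booked.

References: R. Greenberg, LNM 1716 (1999) §2 pp. 69–70, 74–76 (Props. 2.2, 2.4 and the
multiplicative remark); R. Greenberg, V. Vatsal, Invent. Math. 142 (2000) §2 pp. 14–15;
J. H. Silverman, *ATAEC* V.3.1, V.5.2–5.4; J.-P. Serre, *Local Fields* X §1 Prop. 2.
-/

noncomputable section

open scoped Classical NumberField AddSubgroup

universe u

namespace Summit.BirchSwinnertonDyer.Rank1Residual.AdditivePotMult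

open NumberField IsDedekindDomain Field WeierstrassCurve
  Literature.NumberTheory.EllipticCurves
  Literature.NumberTheory.EllipticCurves.GreenbergSelmer
  Literature.NumberTheory.GaloisRepresentations
  Literature.NumberTheory.EllipticCurves.Rank1Residual
  Summit.BirchSwinnertonDyer.Rank1Residual.X2
  Summit.BirchSwinnertonDyer.Rank1Residual.X2.GreenbergVatsalTateDatum
  Summit.BirchSwinnertonDyer.Rank1Residual.X2.GreenbergVatsalTateDatumCofree
  Summit.BirchSwinnertonDyer.Rank1Residual.X2.GreenbergVatsalTateDatumTorsion
  Summit.BirchSwinnertonDyer.Rank1Residual.X2.GreenbergVatsalTateKummer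

namespace RamifiedOrdinaryLinePotMult

section Tate

variable (V : WeierstrassCurve ℚ) [V.IsGloballyMinimal] [V.IsElliptic] (p : ℕ) [hp : Fact p.Prime]
  {v : HeightOneSpectrum (𝓞 ℚ)}

/-- **The Tate line package WITH BOTH LOCAL KUMMER INCLUSIONS, at every `H ≤ Γ_ℚ`** — for a globally
minimal `V/ℚ` MULTIPLICATIVE at the odd prime `p` and the place `v ∋ p`, granted the PUBLISHED Tate
uniformisation A40/A41: a Greenberg local datum `N` (X2's `tateDatum`, `C = ι⁻¹Ψ(μ_{p^∞})`) with
(i) inertia trivial on `V[p^∞]/C`, (ii) `C` divisible, (iii) `#C[p] = p`, (iv) inertia acting on `C[p]`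
through `χ_p` (these four = TB-ROL B-M's `exists_tateDatum_package`), AND for EVERY subgroup
`H ≤ Γ_ℚ` (fixed field `L`, local field `L_w ℚ_p` an arbitrary algebraic extension of `ℚ_p`):
(v) `N.strictKer H ≤ V.localKerOver p H ℚ_v` — "`Im(λ_K) ⊆ Im(κ_K)`", Greenberg p. 76, the tree
THEOREM `strictKer_le_localKerOver_tate` (X2, continuous Hilbert 90); (vi)
`V.localKerOver p H ℚ_v ≤ N.greenbergKer H` — "`Im(κ_K) ⊆`" Greenberg's inertia-form condition,
`tateDatum_kummer` + `localKerOver_le_greenbergKer`. The fact-free bottom of the (M) `R-D` chain.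
[cite: GreenbergLNM1716, §2 pp. 74–76 (Prop. 2.4 and the multiplicative remark) and pp. 69–70]
[cite: GreenbergVatsal2000, §2 pp. 14–15] [cite: SilvermanATAEC1994, Ch. V Thm. 3.1 (c),(d), Lemma 5.2 (c), Thm. 5.3, Cor. 5.4]
[cite: SerreLocalFields1979, Ch. X §1 Prop. 2] -/
theorem exists_tateDatum_package_kummer (hT40 : Silverman1994_thmV53_tateUniformisation.{0})
    (hT41 : Silverman1994_thmV53_corV54_tateUniformisation.{0}) (hp2 : p ≠ 2)
    (hmult : V.HasMultiplicativeReductionAtPrime p) (hpv : ((p : ℕ) : 𝓞 ℚ) ∈ v.asIdeal) :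
    ∃ N : LocalDatum ℚ (V.geomPrimaryTorsion p) v,
      (∀ x ∈ inertia v, ∀ m : V.geomPrimaryTorsion p, x • m - m ∈ N.plus) ∧
      (∀ c ∈ N.plus, ∃ c' ∈ N.plus, p • c' = c) ∧
      Nat.card ↥(N.plus ⊓ AddSubgroup.torsionBy (↥(V.geomPrimaryTorsion p)) (p : ℤ)) = p ∧
      (∀ σ ∈ absInertia (v.adicCompletion ℚ), ∀ k : ℕ, k < p →
        ((GaloisRep.cyclotomicCharacter (v.adicCompletion ℚ) p σ : ℤ_[p]ˣ) : ℤ_[p]) = k →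
        ∀ c ∈ N.plus, p • c = 0 → absGaloisRestrict ℚ (v.adicCompletion ℚ) σ • c = k • c) ∧
      (∀ H : Subgroup (absoluteGaloisGroup ℚ),
        N.strictKer H ≤ V.localKerOver p H (v.adicCompletion ℚ)) ∧
      (∀ H : Subgroup (absoluteGaloisGroup ℚ),
        V.localKerOver p H (v.adicCompletion ℚ) ≤ N.greenbergKer H) := by
  by_cases hs : V.HasSplitMultiplicativeReductionAtPrime p
  · obtain ⟨q, Φ, hq0, hq1, hsurj, hker, hΦσ, -⟩ :=
      hT40 V v (GreenbergVatsalStrictSelmerMultiplicative.hasSplitMultiplicativeReductionAt_of_mem V p hs hpv)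
    have hker' : ∀ u : (AlgebraicClosure (v.adicCompletion ℚ))ˣ, Φ (Additive.ofMul u) = 0 →
        ∃ a : ℤ, (u : AlgebraicClosure (v.adicCompletion ℚ)) =
          algebraMap (v.adicCompletion ℚ) (AlgebraicClosure (v.adicCompletion ℚ)) q ^ a :=
      fun u h ↦ (hker u).1 h
    have hΦI : ∀ σ ∈ absInertia (v.adicCompletion ℚ), ∀ u : (AlgebraicClosure (v.adicCompletion ℚ))ˣ,
        σ • Φ (Additive.ofMul u) = Φ (Additive.ofMul (Units.map
          (Field.absoluteGaloisGroup.toAlgEquiv (v.adicCompletion ℚ) σ :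
            AlgebraicClosure (v.adicCompletion ℚ) →* AlgebraicClosure (v.adicCompletion ℚ)) u)) :=
      fun σ _ u ↦ hΦσ σ u
    -- the untwisted parametrisation in the `±`-form of `strictKer_le_localKerOver_tate`, with `t = 0`
    have hΦσ0 : ∀ (σ : absoluteGaloisGroup (v.adicCompletion ℚ))
        (u : (AlgebraicClosure (v.adicCompletion ℚ))ˣ),
        σ • Φ (Additive.ofMul u) =
          (if Field.absoluteGaloisGroup.toAlgEquiv (v.adicCompletion ℚ) σ (0 : AlgebraicClosure
              (v.adicCompletion ℚ)) = 0 then (1 : ℤ) else -1) •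
          Φ (Additive.ofMul (Units.map
            (Field.absoluteGaloisGroup.toAlgEquiv (v.adicCompletion ℚ) σ :
              AlgebraicClosure (v.adicCompletion ℚ) →* AlgebraicClosure (v.adicCompletion ℚ)) u)) := by
      intro σ u
      rw [map_zero, if_pos rfl, one_zsmul]
      exact hΦσ σ u
    have hts0 : ∀ σ : absoluteGaloisGroup (v.adicCompletion ℚ),
        σ • (0 : AlgebraicClosure (v.adicCompletion ℚ)) = 0 ∨
          σ • (0 : AlgebraicClosure (v.adicCompletion ℚ)) = -0 :=
      fun σ ↦ Or.inl (smul_zero σ)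
    refine ⟨tateDatum V p Φ (fun σ u ↦ Or.inl (hΦσ σ u)), tateDatum_htriv V p Φ _ hsurj hker' hΦI,
      tateDatum_plus_divisible V p Φ _, natCard_tateDatum_plus_inf_torsionBy V p Φ _ hq0 hq1 hker',
      fun σ hσ k hk hχ c hc hpc ↦ ?_, fun H ↦ ?_, fun H ↦ ?_⟩
    · exact smul_eq_nsmul_of_cyclotomicCharacter_eq V p Φ _ hq0 hq1 hker' hΦI hσ hk hχ c hc hpc
    · exact strictKer_le_localKerOver_tate V p Φ 0 hq0 hq1 hker' hΦσ0 _ (fun m ↦ Iff.rfl) H hp2 hts0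
    · exact GreenbergVatsalSelmerLink.localKerOver_le_greenbergKer V p H _
        (tateDatum_kummer V p Φ _ hsurj hker' hΦI hq0 hq1)
  · obtain ⟨q, t, Ψ, hq0, hq1, -, ht2, hsurj, hker, hΨσ, -⟩ :=
      hT41 V v (GreenbergVatsalStrictSelmerMultiplicative.hasMultiplicativeReductionAt_of_mem V p hmult hpv)
    have hker' : ∀ u : (AlgebraicClosure (v.adicCompletion ℚ))ˣ, Ψ (Additive.ofMul u) = 0 →
        ∃ a : ℤ, (u : AlgebraicClosure (v.adicCompletion ℚ)) =
          algebraMap (v.adicCompletion ℚ) (AlgebraicClosure (v.adicCompletion ℚ)) q ^ a :=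
      fun u h ↦ (hker u).1 h
    have hΨI : ∀ σ ∈ absInertia (v.adicCompletion ℚ), ∀ u : (AlgebraicClosure (v.adicCompletion ℚ))ˣ,
        σ • Ψ (Additive.ofMul u) = Ψ (Additive.ofMul (Units.map
          (Field.absoluteGaloisGroup.toAlgEquiv (v.adicCompletion ℚ) σ :
            AlgebraicClosure (v.adicCompletion ℚ) →* AlgebraicClosure (v.adicCompletion ℚ)) u)) := by
      intro σ hσ u
      rw [hΨσ σ u, if_pos (GreenbergVatsalTateDatumRat.inertia_fix_sqrt_gamma V hp2 hmult hpv t ht2 σ hσ),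
        one_zsmul]
    refine ⟨tateDatum V p Ψ (GreenbergVatsalTateDatumSign.sign_disj V Ψ t hΨσ),
      tateDatum_htriv V p Ψ _ hsurj hker' hΨI, tateDatum_plus_divisible V p Ψ _,
      natCard_tateDatum_plus_inf_torsionBy V p Ψ _ hq0 hq1 hker', fun σ hσ k hk hχ c hc hpc ↦ ?_,
      fun H ↦ ?_, fun H ↦ ?_⟩
    · exact smul_eq_nsmul_of_cyclotomicCharacter_eq V p Ψ _ hq0 hq1 hker' hΨI hσ hk hχ c hc hpc
    · exact strictKer_le_localKerOver_tate V p Ψ t hq0 hq1 hker' hΨσ _ (fun m ↦ Iff.rfl) H hp2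
        (smul_sqrt_eq_or V t ht2)
    · exact GreenbergVatsalSelmerLink.localKerOver_le_greenbergKer V p H _
        (tateDatum_kummer V p Ψ _ hsurj hker' hΨI hq0 hq1)

end Tate

/-! ### The (M) classes: the package for the multiplicative `p*`-twist model -/

section Classes

variable {W : WeierstrassCurve ℚ} [W.IsElliptic] {p : ℕ} [hp : Fact p.Prime]

/-- **(M) rows, every odd `p` (`p = 3` included), mod A40/A41: the multiplicative twist model carries
the Tate line package with both local Kummer inclusions at every `H ≤ Γ_ℚ`.** For `E = W`
potentially multiplicative at the odd prime `p` (cell `PotMult W p`): there are a globally minimal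
`V`, MULTIPLICATIVE at `p`, a change of variables `C` with `C • V^{(p*)} = W`
(`PotMult.exists_mult_pStar_twist_model`), and at the place `v ∋ p` a Tate datum `N` of `V` with the
six clauses of `exists_tateDatum_package_kummer`. (The level `H = Gal(ℚ̄/K·ℚ_∞)`, `K = ℚ(√p*)`,
is where `E ≅ V` and T-RD-Δ-K's descent starts.) Nothing about `E` itself is claimed here.
[cite: GreenbergLNM1716, §2 pp. 74–76] [cite: SilvermanATAEC1994, Ch. V Thm. 5.3, Cor. 5.4] -/
theorem PotMult.exists_mult_pStar_twist_model_tateDatum_package_kummer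
    (hT40 : Silverman1994_thmV53_tateUniformisation.{0})
    (hT41 : Silverman1994_thmV53_corV54_tateUniformisation.{0}) (hp2 : p ≠ 2) (hpm : PotMult W p)
    {v : HeightOneSpectrum (𝓞 ℚ)} (hpv : ((p : ℕ) : 𝓞 ℚ) ∈ v.asIdeal) :
    ∃ (V : WeierstrassCurve ℚ) (_ : V.IsElliptic) (_ : V.IsGloballyMinimal) (C : VariableChange ℚ),
      Mult V p ∧ C • V.quadraticTwist ((-1 : ℚ) ^ (p / 2) * p) = W ∧
      ∃ N : LocalDatum ℚ (V.geomPrimaryTorsion p) v,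
        (∀ x ∈ inertia v, ∀ m : V.geomPrimaryTorsion p, x • m - m ∈ N.plus) ∧
        (∀ c ∈ N.plus, ∃ c' ∈ N.plus, p • c' = c) ∧
        Nat.card ↥(N.plus ⊓ AddSubgroup.torsionBy (↥(V.geomPrimaryTorsion p)) (p : ℤ)) = p ∧
        (∀ σ ∈ absInertia (v.adicCompletion ℚ), ∀ k : ℕ, k < p →
          ((GaloisRep.cyclotomicCharacter (v.adicCompletion ℚ) p σ : ℤ_[p]ˣ) : ℤ_[p]) = k →
          ∀ c ∈ N.plus, p • c = 0 → absGaloisRestrict ℚ (v.adicCompletion ℚ) σ • c = k • c) ∧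
        (∀ H : Subgroup (absoluteGaloisGroup ℚ),
          N.strictKer H ≤ V.localKerOver p H (v.adicCompletion ℚ)) ∧
        (∀ H : Subgroup (absoluteGaloisGroup ℚ),
          V.localKerOver p H (v.adicCompletion ℚ) ≤ N.greenbergKer H) := by
  obtain ⟨V, iV, iVm, C, hV, hC⟩ := hpm.exists_mult_pStar_twist_model hp2
  exact ⟨V, iV, iVm, C, hV, hC, exists_tateDatum_package_kummer V p hT40 hT41 hp2 hV hpv⟩

end Classes

end RamifiedOrdinaryLinePotMult

end Summit.BirchSwinnertonDyer.Rank1Residual.AdditivePotMult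

end
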